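import Summits.Schanuel.Schanuel.Theorems.ZilberEacEllipticBaseExample
import Summits.Schanuel.Schanuel.Theorems.ZilberEacCurveGraphFibreCase
import HarnessLib

/-!
# Arbitrary base branches, IX: the genus-one example is IN MANTOVA–MASSER'S CASE — case ∧ dense

HONEST FRAMING.  Cell `pub-schanuel` (Zilber's Exponential-Algebraic Closedness, case ladder;
host summit Schanuel), seat 2, gen 28.  File VII proved that the surface
`S = {x₁² - x₀²x₁ - 1 = 0, y₀ = x₁ - x₀² + 1} ⊆ ℂ² × ℂ²` over the genus-one curve
`C : x₁² - x₀²x₁ = 1` has Zariski-dense exponential points.  This file certifies that `S` is an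
instance of Mantova–Masser's question (their case (dim-π-S-1-free), PLMS 2024 Thm 1.2 / §1 p. 5):
(Part A also records the general packaged statement **`unprojectedDense_curveGraphFibre_of_branch`**:
graph fibres over ANY irreducible plane curve with a fast branch at infinity are dense, files V + VI.)
`S` is irreducible of dimension `2`, has torus points, `dim cl π(S ∩ G²) = dim C = 1`, and `C` is
not a line of rational slope (it contains `(0, 1)`, `(0, -1)` and `(√(3/2), 2)`) —
**`mmCase_genusOne_graphFibre`** — hence **`unprojectedDensityQuestion_instance_genusOne_graphFibre`:
case ∧ dense**.  THE FIRST DECIDED INSTANCE OF THE QUESTION OVER A NON-RATIONAL BASE CURVE in this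
cell.  The question stays OPEN in general; EC(3,2) OPEN; NOT Schanuel's conjecture (neither used
nor implied); EAC ⇏ SC.
-/

noncomputable section

open Filter Topology Set Complex MvPolynomial
open Literature.NumberTheory.Transcendental Literature.ModelTheory.Zilber
open Literature.ModelTheory.ExponentialFields

set_option linter.dupNamespace false

namespace Summit.Schanuel.Schanuel.Theorems


/-! ## Part A. Graph fibres over an arbitrary plane curve: the general statement -/

/-- **Graph fibres over an arbitrary plane curve with a fast branch at infinity are dense.**
`A ∈ ℂ[x₀, x₁]` irreducible with rows `Arow` of positive `x₁`-degree, `R ∈ ℂ[x₀, x₁]`; a branch at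
infinity `(s^{-k}, Φ(s)s^{-M})` of `Z(A)` with `M ≥ k + 1`, `Φ(0) ≠ 0`, along which `R` equals an
analytic `ψ` with `ψ(0) = θ ≠ 0`; an irreducible fibre relation `F(x₀, y₀) = 0` of positive degree
holding along `(s^{-k}, ψ(s))` and having a parametrised zero branch.  Then the surface
`{A(x₀, x₁) = 0, y₀ = R(x₀, x₁)}` has Zariski-dense exponential points.  (Files V + VI.)
[cite: MantovaMasser2023, §1 Further remarks, p. 5 (the question, open in general)] (new) -/
theorem unprojectedDense_curveGraphFibre_of_branch (A R : MvPolynomial (Fin 2) ℂ)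
    (hirr : Irreducible A) (Arow : Polynomial (Polynomial ℂ))
    (hArows : ∀ x y : ℂ, MvPolynomial.eval ![x, y] A = (Arow.map (Polynomial.evalRingHom x)).eval y)
    (hA1 : Arow.natDegree ≠ 0)
    (F : Polynomial (Polynomial ℂ)) (hFirr : Irreducible F) (hF1 : F.natDegree ≠ 0)
    {k M : ℕ} (hk : 1 ≤ k) (hM : k + 1 ≤ M)
    {ψ : ℂ → ℂ} (hψ : AnalyticAt ℂ ψ 0) {θ : ℂ} (hθ0 : θ ≠ 0) (hψ0 : ψ 0 = θ)
    {Φ : ℂ → ℂ} (hΦ : AnalyticAt ℂ Φ 0) (hΦ0 : Φ 0 ≠ 0)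
    (hbranch : ∀ᶠ s in 𝓝[≠] (0 : ℂ), (F.map (Polynomial.evalRingHom (s ^ k)⁻¹)).eval (ψ s) = 0)
    (hcurve : ∀ᶠ s in 𝓝[≠] (0 : ℂ), MvPolynomial.eval ![(s ^ k)⁻¹, Φ s * (s ^ M)⁻¹] A = 0)
    (hR : ∀ᶠ s in 𝓝[≠] (0 : ℂ), ψ s = MvPolynomial.eval ![(s ^ k)⁻¹, Φ s * (s ^ M)⁻¹] R)
    {γ η : ℂ → ℂ} (hγan : AnalyticAt ℂ γ 0) (hηan : AnalyticAt ℂ η 0) (hη0 : η 0 = 0)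
    (hγ' : ∀ᶠ t in 𝓝[≠] (0 : ℂ), deriv γ t ≠ 0) (hηne : ¬ ∀ᶠ t in 𝓝 (0 : ℂ), η t = 0)
    (hFγ : ∀ᶠ t in 𝓝 (0 : ℂ), (F.map (Polynomial.evalRingHom (γ t))).eval (η t) = 0) :
    UnprojectedDense {w : Fin 2 ⊕ Fin 2 → ℂ |
      MvPolynomial.eval ![w (Sum.inl 0), w (Sum.inl 1)] A = 0 ∧
      w (Sum.inr 0) = MvPolynomial.eval ![w (Sum.inl 0), w (Sum.inl 1)] R} := by
  have hS := isIrreducibleClosed_curveGraphFibre R hirr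
  have hdim := zariskiDim_curveGraphFibre R hirr
  have hAirr : Irreducible Arow := (irreducible_rows_iff hArows).1 hirr
  have hbase : ∀ᶠ s in 𝓝[≠] (0 : ℂ),
      (Arow.map (Polynomial.evalRingHom (s ^ k)⁻¹)).eval (Φ s * (s ^ M)⁻¹) = 0 := by
    filter_upwards [hcurve] with s hs
    rw [← hArows]
    exact hs
  have hgerm : ∀ᶠ s in 𝓝[≠] (0 : ℂ),
      (Sum.elim ![(s ^ k)⁻¹, Φ s * (s ^ M)⁻¹] ![ψ s, Complex.exp (Φ s * (s ^ M)⁻¹)] :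
        Fin 2 ⊕ Fin 2 → ℂ) ∈ {w : Fin 2 ⊕ Fin 2 → ℂ |
      MvPolynomial.eval ![w (Sum.inl 0), w (Sum.inl 1)] A = 0 ∧
      w (Sum.inr 0) = MvPolynomial.eval ![w (Sum.inl 0), w (Sum.inl 1)] R} := by
    filter_upwards [hcurve, hR] with s hA hRs
    refine ⟨?_, ?_⟩
    · simp only [Sum.elim_inl, Matrix.cons_val_zero, Matrix.cons_val_one]
      exact hA
    · simp only [Sum.elim_inr, Sum.elim_inl, Matrix.cons_val_zero, Matrix.cons_val_one]
      exact hRs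
  exact unprojectedDense_branch_cycle_zeroBranch hS (le_of_eq hdim) F hFirr hF1 Arow hAirr hA1 hk hM
    hψ hθ0 hψ0 hΦ hΦ0 hbranch hbase hgerm hγan hηan hη0 hγ' hηne hFγ

/-! ## Part B. The genus-one example is in the case -/

/-- Evaluation of the base polynomial `x₁² - x₀²x₁ - 1` at a point. -/
theorem eval_genusOne_baseMv' (x : Fin 2 → ℂ) :
    MvPolynomial.eval x (X 1 ^ 2 - X 0 ^ 2 * X 1 - 1 : MvPolynomial (Fin 2) ℂ) =
      x 1 ^ 2 - x 0 ^ 2 * x 1 - 1 := by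
  simp

/-- **The genus-one example is in Mantova–Masser's case (dim-π-S-1-free).** (new) -/
theorem mmCase_genusOne_graphFibre :
    MMCaseDimPiOneFree {w : Fin 2 ⊕ Fin 2 → ℂ |
      MvPolynomial.eval ![w (Sum.inl 0), w (Sum.inl 1)]
        (X 1 ^ 2 - X 0 ^ 2 * X 1 - 1 : MvPolynomial (Fin 2) ℂ) = 0 ∧
      w (Sum.inr 0) = MvPolynomial.eval ![w (Sum.inl 0), w (Sum.inl 1)]
        (X 1 - X 0 ^ 2 + 1 : MvPolynomial (Fin 2) ℂ)} := by
  refine mmCase_curveGraphFibre irreducible_genusOne_baseMv ?_ ?_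
  · -- the point `(0, 1)` of `C` has `R = 2 ≠ 0`
    refine ⟨![0, 1], ?_, ?_⟩
    · rw [eval_genusOne_baseMv']; simp
    · simp
  · -- `C` is not contained in a line `m₀x₀ + m₁x₁ = c`
    intro m hm c
    by_cases h1 : (m 1 : ℂ) * 1 ≠ c
    · refine ⟨![0, 1], ?_, ?_⟩
      · rw [eval_genusOne_baseMv']; simp
      · simpa using h1
    by_cases h2 : (m 1 : ℂ) * (-1) ≠ c
    · refine ⟨![0, -1], ?_, ?_⟩
      · rw [eval_genusOne_baseMv']; simp
      · simpa using h2
    push Not at h1 h2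
    have hm1 : (m 1 : ℂ) = 0 := by linear_combination (h1 - h2) / 2
    have hc : c = 0 := by rw [← h1, hm1, zero_mul]
    have hm1Z : m 1 = 0 := by exact_mod_cast hm1
    have hm0 : m 0 ≠ 0 := by
      intro h0
      apply hm
      funext i
      fin_cases i
      · exact h0
      · exact hm1Z
    -- the point `(a, 2)` with `a² = 3/2`
    set a : ℂ := ((Real.sqrt (3 / 2) : ℝ) : ℂ) with ha
    have ha2 : a ^ 2 = 3 / 2 := by
      rw [ha, ← Complex.ofReal_pow, Real.sq_sqrt (by norm_num)]
      push_cast; ring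
    have ha0 : a ≠ 0 := by
      intro h
      rw [h] at ha2
      norm_num at ha2
    refine ⟨![a, 2], ?_, ?_⟩
    · rw [eval_genusOne_baseMv']
      simp only [Matrix.cons_val_one, Matrix.cons_val_zero]
      rw [ha2]; norm_num
    · simp only [Matrix.cons_val_zero, Matrix.cons_val_one, hm1, hc, zero_mul, add_zero]
      exact mul_ne_zero (by exact_mod_cast hm0) ha0

/-- **Mantova–Masser's question for the genus-one example: case ∧ dense.**
[cite: MantovaMasser2023, §1 Further remarks, p. 5 (the question, open in general)] (new) -/
theorem unprojectedDensityQuestion_instance_genusOne_graphFibre :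
    MMCaseDimPiOneFree {w : Fin 2 ⊕ Fin 2 → ℂ |
        MvPolynomial.eval ![w (Sum.inl 0), w (Sum.inl 1)]
          (X 1 ^ 2 - X 0 ^ 2 * X 1 - 1 : MvPolynomial (Fin 2) ℂ) = 0 ∧
        w (Sum.inr 0) = MvPolynomial.eval ![w (Sum.inl 0), w (Sum.inl 1)]
          (X 1 - X 0 ^ 2 + 1 : MvPolynomial (Fin 2) ℂ)} ∧
      UnprojectedDense {w : Fin 2 ⊕ Fin 2 → ℂ |
        MvPolynomial.eval ![w (Sum.inl 0), w (Sum.inl 1)]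
          (X 1 ^ 2 - X 0 ^ 2 * X 1 - 1 : MvPolynomial (Fin 2) ℂ) = 0 ∧
        w (Sum.inr 0) = MvPolynomial.eval ![w (Sum.inl 0), w (Sum.inl 1)]
          (X 1 - X 0 ^ 2 + 1 : MvPolynomial (Fin 2) ℂ)} :=
  ⟨mmCase_genusOne_graphFibre, unprojectedDense_genusOne_graphFibre⟩

/-- **The same in plain coordinates**: the surface `{x₁² - x₀²x₁ - 1 = 0, y₀ = x₁ - x₀² + 1}` is in
Mantova–Masser's case AND has Zariski-dense exponential points.
[cite: MantovaMasser2023, §1 Further remarks, p. 5 (the question, open in general)] (new) -/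
theorem unprojectedDensityQuestion_instance_genusOne_graphFibre' :
    MMCaseDimPiOneFree {w : Fin 2 ⊕ Fin 2 → ℂ |
        w (Sum.inl 1) ^ 2 - w (Sum.inl 0) ^ 2 * w (Sum.inl 1) - 1 = 0 ∧
        w (Sum.inr 0) = w (Sum.inl 1) - w (Sum.inl 0) ^ 2 + 1} ∧
      UnprojectedDense {w : Fin 2 ⊕ Fin 2 → ℂ |
        w (Sum.inl 1) ^ 2 - w (Sum.inl 0) ^ 2 * w (Sum.inl 1) - 1 = 0 ∧
        w (Sum.inr 0) = w (Sum.inl 1) - w (Sum.inl 0) ^ 2 + 1} := by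
  have e : {w : Fin 2 ⊕ Fin 2 → ℂ |
      MvPolynomial.eval ![w (Sum.inl 0), w (Sum.inl 1)]
        (X 1 ^ 2 - X 0 ^ 2 * X 1 - 1 : MvPolynomial (Fin 2) ℂ) = 0 ∧
      w (Sum.inr 0) = MvPolynomial.eval ![w (Sum.inl 0), w (Sum.inl 1)]
        (X 1 - X 0 ^ 2 + 1 : MvPolynomial (Fin 2) ℂ)} =
      {w : Fin 2 ⊕ Fin 2 → ℂ | w (Sum.inl 1) ^ 2 - w (Sum.inl 0) ^ 2 * w (Sum.inl 1) - 1 = 0 ∧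
        w (Sum.inr 0) = w (Sum.inl 1) - w (Sum.inl 0) ^ 2 + 1} := by
    ext w
    simp
  have h := unprojectedDensityQuestion_instance_genusOne_graphFibre
  rw [e] at h
  exact h

end Summit.Schanuel.Schanuel.Theorems
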